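import Summits.ValiantsHypothesis.ValiantsHypothesis.Theses.ProjectionRigidity
import Literature.Computability.AlgebraicComplexity.PermanentUniversality
import Literature.Computability.AlgebraicComplexity.VPDeterminantalQPProofs
import Literature.Computability.AlgebraicComplexity.DeterminantUniversalityBCS
import Literature.Computability.AlgebraicComplexity.ValiantClassesProofs

/-!
# Sketch for crux-ideate stmt-ValiantsHypothesis-16003 (`PdcQpOfVp`), ideator 2, round 1

First lemmas of the two idea cards, elaborated against the tree, plus the common endpoint:
the named fact `BCS1997_cor_21_40 ℂ` closes the crux in three lines (PROVED below), and
`BCS1997_thm_21_27_det k` + "VP ⊆ VQP_e in the `ArithExpr` carrier" gives `BCS1997_cor_21_40 k`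
(PROVED below modulo those two named inputs).

* Idea 1 `hessenberg-subdiagonal-twist`: `det (hessNeg n w) = pathSum w n` (first lemma,
  stated; n = 1, 2, 3 checked by computation) ⇒ `BCS1997_thm_21_27_det` from the tree's PROVED
  permanent-side DAG calculus (`ArithExpr.pathSum_dagWeights`) — PROVED below modulo the first lemma.
* Idea 2 `projective-readout`: `HasProjInvRepr` (inverse read-outs with projection entries);
  first lemma `HasProjInvRepr.var` PROVED (the constant read-out vector carries the sign).
-/

namespace Summit.ValiantsHypothesis.ValiantsHypothesis.Cruxes.PdcQpOfVp.Sketch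

open MvPolynomial Matrix Finset Literature.Computability.AlgebraicComplexity

/-! ## Common endpoint: the named fact (BCS 1997 Cor. (21.40)) closes the crux -/

theorem pdcQpOfVp_of_cor_21_40 (h : BCS1997_cor_21_40 ℂ) :
    Summit.ValiantsHypothesis.ValiantsHypothesis.Theses.ProjectionRigidity.PdcQpOfVp := by
  intro hVP
  obtain ⟨t, ⟨c, hc⟩, ht⟩ :=
    h (fun n => Fin n × Fin n) (fun n => perPoly (Fin n) ℂ) (IsVPFamily.isVQPFamily hVP)
  exact ⟨c, fun n => (Nat.sInf_le (ht n)).trans (hc n)⟩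

/-- Upstream input U shared by both ideas: `VP ⊆ VQP_e` in the `ArithExpr` carrier (the tree
proves it in the `ArithCircuit`/`formulaComplexity` carrier, `isVQPeFamily_iff_isVQPFamily`;
the `ArithExpr` version is the same stage recursion with leaf `ArithExpr.affineExpr`). -/
def ArithExprVQPe (k : Type) [Field k] : Prop :=
  ∀ (σ : ℕ → Type) [∀ n, Fintype (σ n)] (f : ∀ n, MvPolynomial (σ n) k), IsVQPFamily f →
    ∃ c : ℕ, ∀ n, ∃ φ : ArithExpr k (σ n), φ.eval = f n ∧ φ.size ≤ 2 ^ ((Nat.log 2 n + c) ^ c)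

/-- qp arithmetic: `2 * 2^((ℓ+c)^c) + 2 ≤ 2^((ℓ + (c+2))^(c+2))`. -/
theorem two_mul_two_pow_add_two_le (ℓ c : ℕ) :
    2 * 2 ^ ((ℓ + c) ^ c) + 2 ≤ 2 ^ ((ℓ + (c + 2)) ^ (c + 2)) := by
  have h1 : (ℓ + c) ^ c + 2 ≤ (ℓ + (c + 2)) ^ (c + 2) := by
    have hm : (ℓ + c) ^ c ≤ (ℓ + (c + 2)) ^ c := Nat.pow_le_pow_left (by omega) c
    have hsq : 4 ≤ (ℓ + (c + 2)) ^ 2 := by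
      calc 4 = 2 ^ 2 := rfl
        _ ≤ (ℓ + (c + 2)) ^ 2 := Nat.pow_le_pow_left (by omega) 2
    have hone : 1 ≤ (ℓ + c) ^ c := by
      rcases Nat.eq_zero_or_pos c with hc | hc
      · subst hc; simp
      · exact Nat.one_le_pow _ _ (by omega)
    calc (ℓ + c) ^ c + 2 ≤ (ℓ + c) ^ c * 4 := by omega
      _ ≤ (ℓ + (c + 2)) ^ c * (ℓ + (c + 2)) ^ 2 := Nat.mul_le_mul hm hsq
      _ = (ℓ + (c + 2)) ^ (c + 2) := by rw [← pow_add]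
  calc 2 * 2 ^ ((ℓ + c) ^ c) + 2 ≤ 2 ^ ((ℓ + c) ^ c + 2) := by
        rw [pow_add]; have := Nat.one_le_two_pow (n := (ℓ + c) ^ c); omega
    _ ≤ 2 ^ ((ℓ + (c + 2)) ^ (c + 2)) := Nat.pow_le_pow_right (by norm_num) h1

/-- Cor. (21.40) from Thm. (21.27)-det and U (PROVED). -/
theorem cor_21_40_of (k : Type) [Field k] (hU : ArithExprVQPe k) (h27 : BCS1997_thm_21_27_det k) :
    BCS1997_cor_21_40 k := by
  intro σ _ f hf
  obtain ⟨c, hc⟩ := hU σ f hf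
  choose φ hφ using hc
  refine ⟨fun n => 2 * (φ n).size + 2, ⟨c + 2, fun n => ?_⟩, fun n => (hφ n).1 ▸ h27 (φ n)⟩
  calc 2 * (φ n).size + 2 ≤ 2 * 2 ^ ((Nat.log 2 n + c) ^ c) + 2 := by
        have := (hφ n).2; omega
    _ ≤ 2 ^ ((Nat.log 2 n + (c + 2)) ^ (c + 2)) := two_mul_two_pow_add_two_le _ _

/-! ## Idea 1: the Hessenberg subdiagonal twist -/

section Hess

variable {R : Type*} [CommRing R]

/-- Lower Hessenberg matrix of a weighted transitive DAG on `{0,…,n}` with subdiagonal `-1`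
(the tree's `hess n w` has subdiagonal `+1` and PERMANENT `= pathSum w n`). -/
def hessNeg (n : ℕ) (w : ℕ → ℕ → R) : Matrix (Fin n) (Fin n) R := fun r c =>
  if r.val = c.val + 1 then -1 else if r.val ≤ c.val then w r.val (c.val + 1) else 0

/-- FIRST LEMMA (Idea 1): the DETERMINANT of the `-1`-subdiagonal Hessenberg matrix is the path
sum — each interval cycle `(a b b-1 … a+1)` of length `b-a+1` has sign `(-1)^(b-a)` and uses
exactly `b-a` subdiagonal entries `-1`, so the signs cancel termwise against `per (hess n w)`.
Proof plan: Laplace along the last row (`Matrix.det_succ_row _ (Fin.last m)`), minors verbatim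
as in `permanent_hess`. -/
theorem det_hessNeg (n : ℕ) (w : ℕ → ℕ → R) : (hessNeg n w).det = pathSum w n := by
  induction n generalizing w with
  | zero => rw [pathSum_zero]; exact Matrix.det_isEmpty
  | succ m ih =>
    rw [Matrix.det_succ_row _ (Fin.last m), Fin.sum_univ_castSucc]
    have hlast : hessNeg (m + 1) w (Fin.last m) (Fin.last m) = w m (m + 1) := by
      simp [hessNeg]
    have hminor_last : (hessNeg (m + 1) w).submatrix (Fin.last m).succAbove (Fin.last m).succAbove
        = hessNeg m w := by
      ext r c
      simp [hessNeg, Fin.succAbove_last]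
    have hsign_last : ((-1 : R) ^ ((Fin.last m : ℕ) + (Fin.last m : ℕ))) = 1 := by
      rw [Fin.val_last, ← two_mul, pow_mul, neg_one_sq, one_pow]
    rw [hlast, hminor_last, ih w, hsign_last, one_mul]
    cases m with
    | zero =>
      rw [pathSum_one, pathSum_zero]
      simp
    | succ m' =>
      -- the castSucc part of the last row has a single nonzero entry `-1`, at column `m'`
      rw [Finset.sum_eq_single (Fin.last m')]
      · have hentry :
            hessNeg (m' + 2) w (Fin.last (m' + 1)) (Fin.castSucc (Fin.last m')) = -1 := by
          simp [hessNeg]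
        have hsign : ((-1 : R) ^ ((Fin.last (m' + 1) : ℕ) + (Fin.castSucc (Fin.last m') : ℕ)))
            = -1 := by
          rw [Fin.val_last, Fin.val_castSucc, Fin.val_last,
            show m' + 1 + m' = 2 * m' + 1 by ring, pow_succ, pow_mul, neg_one_sq, one_pow, one_mul]
        set w' : ℕ → ℕ → R := fun a c => if c = m' + 1 then w a (m' + 2) else w a c with hw'
        have hminor : (hessNeg (m' + 2) w).submatrix (Fin.last (m' + 1)).succAbove
            (Fin.castSucc (Fin.last m')).succAbove = hessNeg (m' + 1) w' := by
          ext r c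
          rcases Fin.eq_castSucc_or_eq_last c with ⟨c', rfl⟩ | rfl
          · have h1 : (Fin.castSucc (Fin.last m')).succAbove (Fin.castSucc c') =
                Fin.castSucc (Fin.castSucc c') :=
              Fin.succAbove_of_castSucc_lt _ _
                (Fin.castSucc_lt_castSucc_iff.2 (Fin.castSucc_lt_last c'))
            have hc' := c'.isLt
            simp [hessNeg, h1, Fin.succAbove_last, hw', Nat.ne_of_lt hc']
          · have h1 : (Fin.castSucc (Fin.last m')).succAbove (Fin.last m') = Fin.last (m' + 1) := by
              rw [Fin.succAbove_of_le_castSucc _ _ le_rfl, Fin.succ_last]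
            have hr := r.isLt
            simp [hessNeg, h1, Fin.succAbove_last, hw']
            rw [if_neg (by omega), if_neg (by omega), if_pos (by omega)]
        have key : pathSum w' (m' + 1) + w (m' + 1) (m' + 2) * pathSum w (m' + 1) =
            pathSum w (m' + 2) := by
          rw [pathSum_succ, pathSum_succ w (m' + 1),
            Finset.sum_range_succ (fun a => pathSum w a * w a (m' + 2))]
          congr 1
          · refine sum_congr rfl fun a ha => ?_
            rw [mem_range] at ha
            rw [pathSum_congr (w := w') (w' := w)
              (fun a' c hc => by rw [hw']; dsimp only; rw [if_neg (by omega)])]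
            simp [hw']
          · ring
        rw [hentry, hsign, hminor, ih w', ← key]
        ring
      · intro j _ hj
        have : hessNeg (m' + 2) w (Fin.last (m' + 1)) (Fin.castSucc j) = 0 := by
          have hj' : j.val ≠ m' := fun h => hj (Fin.ext (by rw [Fin.val_last]; exact h))
          have hjlt := j.isLt
          have e1 : ¬ (m' + 1 = j.val + 1) := by omega
          have e2 : ¬ (m' + 1 ≤ j.val) := by omega
          simp only [hessNeg, Fin.val_last, Fin.val_castSucc, e1, e2, if_false]
        rw [this, mul_zero, zero_mul]
      · intro h; exact absurd (mem_univ _) h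

/-- Cheapest falsifier, run: n = 1. -/
example (w : ℕ → ℕ → R) : (hessNeg 1 w).det = pathSum w 1 := by
  rw [Matrix.det_unique, pathSum_one]
  simp [hessNeg]

/-- Cheapest falsifier, run: n = 2 (`w 0 2 + w 0 1 * w 1 2`). -/
example (w : ℕ → ℕ → R) : (hessNeg 2 w).det = pathSum w 2 := by
  rw [Matrix.det_fin_two, pathSum_two]
  simp [hessNeg]
  ring

/-- Cheapest falsifier, run: n = 3 (the four paths `0→3`). -/
example (w : ℕ → ℕ → R) : (hessNeg 3 w).det = pathSum w 3 := by
  rw [Matrix.det_fin_three, pathSum_succ, Finset.sum_range_succ, Finset.sum_range_succ,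
    Finset.sum_range_one, pathSum_zero, pathSum_one, pathSum_two]
  simp [hessNeg]
  ring

end Hess

section Transfer

variable {k : Type} [Field k]

/-- Idea 1, step 2 (PROVED modulo the first lemma): the determinant half of BCS Thm. (21.27)
at the printed size `2u+2`, by reading the tree's PROVED DAG identity
`ArithExpr.pathSum_dagWeights : pathSum (wval φ.dagWeights) (2u+2) = φ.eval` through `hessNeg`
instead of `hess`. Entries of `hessNeg _ (wval W)` are `-1 = C (-1)`, `0 = C 0`, or
`entryVal (W a b) ∈ {C c} ∪ {X i}`: a projection of `DET`. -/
theorem bcs_21_27_det_of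
    (hdet : ∀ {σ : Type} (n : ℕ) (w : ℕ → ℕ → MvPolynomial σ k), (hessNeg n w).det = pathSum w n) :
    BCS1997_thm_21_27_det k := by
  intro σ φ
  refine ⟨fun ij => hessNeg (2 * φ.size + 2) (wval φ.dagWeights) ij.1 ij.2, fun ij => ?_, ?_⟩
  · simp only [hessNeg]
    split_ifs with h1 h2
    · exact Or.inr ⟨-1, by simp⟩
    · rcases hW : φ.dagWeights ij.1.val (ij.2.val + 1) with c | i
      · exact Or.inr ⟨c, by simp [wval, hW]⟩
      · exact Or.inl ⟨i, by simp [wval, hW]⟩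
    · exact Or.inr ⟨0, by simp⟩
  · rw [detPoly, AlgHom.map_det, Matrix.mvPolynomialX_mapMatrix_aeval]
    rw [← ArithExpr.pathSum_dagWeights φ, ← hdet]

/-- **Discharge of the named fact `BCS1997_thm_21_27_det`** (determinant half of BCS 1997
Thm. (21.27), Valiant 1979 Thm. 1 with the expression-size bound `2u+2`), over every field —
PROVED (sorry-free): `det_hessNeg` + the tree's permanent-side DAG calculus. -/
theorem bcs1997_thm_21_27_det_holds (k : Type) [Field k] : BCS1997_thm_21_27_det k :=
  bcs_21_27_det_of (fun n w => det_hessNeg n w)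

/-- Cor. (21.40) modulo the single upstream input U (PROVED otherwise). -/
theorem bcs1997_cor_21_40_of_U (k : Type) [Field k] (hU : ArithExprVQPe k) : BCS1997_cor_21_40 k :=
  cor_21_40_of k hU (bcs1997_thm_21_27_det_holds k)

/-- Idea 1 endpoint: the crux modulo ONLY the upstream input U (everything else PROVED here). -/
theorem pdcQpOfVp_of_idea1 (hU : ArithExprVQPe ℂ) :
    Summit.ValiantsHypothesis.ValiantsHypothesis.Theses.ProjectionRigidity.PdcQpOfVp :=
  pdcQpOfVp_of_cor_21_40 (bcs1997_cor_21_40_of_U ℂ hU)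

end Transfer

/-! ## Idea 2: projective inverse read-outs -/

section ProjReadout

variable {k : Type} [CommRing k] {σ : Type}

/-- `HasProjInvRepr g m`: as the tree's `HasInvRepr g m` (BCS (21.27) normal form read through the
Schur complement: `g = vᵀ B⁻¹ w`, `det B = 1`, `v w` CONSTANT), but every entry of `B` is a
variable or a constant — a Valiant projection pattern. -/
def HasProjInvRepr (g : MvPolynomial σ k) (m : ℕ) : Prop :=
  ∃ (ι : Type) (_ : Fintype ι) (_ : DecidableEq ι) (B : Matrix ι ι (MvPolynomial σ k))
    (v w : ι → k), Fintype.card ι ≤ m ∧ (∀ i j, (∃ u, B i j = X u) ∨ ∃ c, B i j = C c) ∧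
      B.det = 1 ∧ (fun i => C (v i)) ⬝ᵥ (B⁻¹ *ᵥ fun j => C (w j)) = g

/-- FIRST LEMMA (Idea 2, PROVED): the `2 × 2` projective leaf of a variable. `B = [[1, X u], [0, 1]]`
has `B⁻¹ = [[1, -X u], [0, 1]]`; reading out with `v = e₀` and the CONSTANT `w = -e₁` gives
`vᵀ B⁻¹ w = (-X u)(-1) = X u` — the sign that blocks `[[1, -a], [0, 1]]` from being a projection
is carried by the constant read-out vector, not by the matrix. -/
theorem HasProjInvRepr.var (u : σ) : HasProjInvRepr (X u : MvPolynomial σ k) 2 := by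
  refine ⟨Fin 2, inferInstance, inferInstance, !![1, X u; 0, 1], ![1, 0], ![0, -1], by simp,
    ?_, ?_, ?_⟩
  · intro i j
    fin_cases i <;> fin_cases j
    · exact Or.inr ⟨1, by simp⟩
    · exact Or.inl ⟨u, by simp⟩
    · exact Or.inr ⟨0, by simp⟩
    · exact Or.inr ⟨1, by simp⟩
  · rw [Matrix.det_fin_two_of]
    ring
  · have hinv : (!![1, X u; 0, 1] : Matrix (Fin 2) (Fin 2) (MvPolynomial σ k))⁻¹ =
        !![1, -X u; 0, 1] := by
      apply Matrix.inv_eq_right_inv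
      rw [Matrix.mul_fin_two, Matrix.one_fin_two]
      congr <;> ring
    rw [hinv]
    simp [Matrix.mulVec, dotProduct, Fin.sum_univ_two]

/-- The `1 × 1` projective leaf of a constant: `B = (1)`, `v = (c)`, `w = (1)`. -/
theorem HasProjInvRepr.const (c : k) : HasProjInvRepr (C c : MvPolynomial σ k) 1 := by
  refine ⟨Unit, inferInstance, inferInstance, 1, fun _ => c, fun _ => 1, by simp,
    fun i j => Or.inr ⟨1, by simp⟩, by simp, ?_⟩
  simp [Matrix.mulVec, dotProduct]

/-- Idea 2, the calculus (statements; proofs = the tree's `HasInvRepr.add/mul/hasDetRepr`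
verbatim, whose new entries are the constants `0`, `-(w₁ i v₂ j)`, `-w i`, `v j`). -/
def Calculus : Prop :=
  (∀ {g₁ g₂ : MvPolynomial σ k} {m₁ m₂ : ℕ}, HasProjInvRepr g₁ m₁ → HasProjInvRepr g₂ m₂ →
      HasProjInvRepr (g₁ + g₂) (m₁ + m₂)) ∧
  (∀ {g₁ g₂ : MvPolynomial σ k} {m₁ m₂ : ℕ}, HasProjInvRepr g₁ m₁ → HasProjInvRepr g₂ m₂ →
      HasProjInvRepr (g₁ * g₂) (m₁ + m₂)) ∧
  (∀ {g : MvPolynomial σ k} {m : ℕ}, HasProjInvRepr g m → IsDetProjection g (m + 1))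

/-- Idea 2 endpoint shape (PROVED modulo `Calculus`): every expression of size `u` has a projective
read-out of size `2u + 2`, hence is a projection of `DET_{2u+3}`. -/
theorem isDetProjection_eval_of_calculus (hC : Calculus (k := k) (σ := σ)) (φ : ArithExpr k σ) :
    IsDetProjection φ.eval (2 * φ.size + 3) := by
  have hmono : ∀ {g : MvPolynomial σ k} {m m' : ℕ}, HasProjInvRepr g m → m ≤ m' →
      HasProjInvRepr g m' := by
    rintro g m m' ⟨ι, _, _, B, v, w, hc, hB, hd, hg⟩ hm
    exact ⟨ι, inferInstance, inferInstance, B, v, w, hc.trans hm, hB, hd, hg⟩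
  have key : ∀ ψ : ArithExpr k σ, HasProjInvRepr ψ.eval (2 * ψ.size + 2) := by
    intro ψ
    induction ψ with
    | var i => exact hmono (HasProjInvRepr.var i) (by simp)
    | const c => exact hmono (HasProjInvRepr.const c) (by simp)
    | add ψ₁ ψ₂ ih₁ ih₂ =>
      exact hmono (hC.1 ih₁ ih₂) (by simp [ArithExpr.size_add]; omega)
    | mul ψ₁ ψ₂ ih₁ ih₂ =>
      exact hmono (hC.2.1 ih₁ ih₂) (by simp [ArithExpr.size_mul]; omega)
  exact hC.2.2 (key φ)

end ProjReadout

end Summit.ValiantsHypothesis.ValiantsHypothesis.Cruxes.PdcQpOfVp.Sketch
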